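import Summits.AtomisticToContinuum.Crystallization.Theorems.ExcessDecayLiouvilleHcpLiouvilleBlowdownGreenL2
import Summits.AtomisticToContinuum.Crystallization.Theorems.ExcessDecayLiouvilleTranslation
import Summits.AtomisticToContinuum.Crystallization.Theorems.ExcessDecayLiouvilleLatticeCoordinates

/-!
# `ExcessDecayLiouville.HcpLiouville` (stmt-AtomisticToContinuum-9332), line `Sketch` v4: lattice translations and the Green's operator

Part H3b of stub `stub_green`, lead file.  For a solution operator `𝒢` of the force-constant operator that is
COVARIANT under lattice translations (clause (vi) of the registered sub-goal `blowdown_greenSolve`) and whose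
translation differences along the three generators are square-summable (clause (iv)), the response to a point force
`δ_a ξ` moved by a lattice vector `A z(i,j,k)` differs from the original response by a field of `ℓ²`-norm at most
`(|i| + |j| + |k|) · B`:

* `Blowdown.tsum_shift_eq`, `Blowdown.summable_shift_iff` — reindexing `Σ'` over the sites by a lattice translation;
* `Blowdown.sq_summable_add` — two-term Minkowski in `ℓ²` (squared form);
* `Blowdown.translate_sq_le` — `Σ'_x ‖G x − G (x − A z(i,j,k))‖² ≤ ((|i|+|j|+|k|)·B)²` from the one-step bounds;
* `Blowdown.green_single_translate` — `𝒢 (δ_{a + Ae} ξ) = 𝒢 (δ_a ξ)(· − Ae)` on the sites.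

All hypotheses on `𝒢` are taken in the literal form of the registered clauses; all `[folklore]`; a `--supports`
helper for item stmt-AtomisticToContinuum-9332, nothing here closes an item.
-/

noncomputable section

namespace Summit.AtomisticToContinuum.Crystallization.Theorems.ExcessDecayLiouville

open scoped BigOperators Topology Classical InnerProductSpace RealInnerProductSpace
open Literature.MathematicalPhysics.StatisticalMechanics
open Summit.AtomisticToContinuum.Crystallization.Theses.ExcessDecayLiouville
open Summit.AtomisticToContinuum.Crystallization.Theorems.PhononStabilityNegative

namespace Blowdown

section

variable {t : Fin 2 → EuclideanSpace ℝ (Fin 3)} {A : EuclideanSpace ℝ (Fin 3) →L[ℝ] EuclideanSpace ℝ (Fin 3)}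

/-! ## Reindexing by lattice translations -/

/-- Reindexing a `tsum` over the sites by the translation `x ↦ x + A l`, `l ∈ Λ₀`. [folklore] -/
theorem tsum_shift_eq {α : Type*} [AddCommMonoid α] [TopologicalSpace α] (F : EuclideanSpace ℝ (Fin 3) → α)
    {l : EuclideanSpace ℝ (Fin 3)} (hl : l ∈ Λ₀) :
    ∑' x : Sites₀ t A, F ((x : EuclideanSpace ℝ (Fin 3)) + A l) = ∑' x : Sites₀ t A, F x := by
  obtain ⟨e, he⟩ := exists_sitesShift (t := t) (A := A) hl
  calc ∑' x : Sites₀ t A, F ((x : EuclideanSpace ℝ (Fin 3)) + A l)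
      = ∑' x : Sites₀ t A, F ((e x : Sites₀ t A) : EuclideanSpace ℝ (Fin 3)) := tsum_congr fun x => by rw [he x]
    _ = ∑' x : Sites₀ t A, F x := e.tsum_eq (fun x : Sites₀ t A => F x)

/-- Reindexing a `tsum` over the sites by the translation `x ↦ x − A l`, `l ∈ Λ₀`. [folklore] -/
theorem tsum_shift_eq' {α : Type*} [AddCommMonoid α] [TopologicalSpace α] (F : EuclideanSpace ℝ (Fin 3) → α)
    {l : EuclideanSpace ℝ (Fin 3)} (hl : l ∈ Λ₀) :
    ∑' x : Sites₀ t A, F ((x : EuclideanSpace ℝ (Fin 3)) - A l) = ∑' x : Sites₀ t A, F x := by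
  have h := tsum_shift_eq (t := t) (A := A) F (neg_mem_Λ₀ hl)
  simpa [sub_eq_add_neg] using h

/-- Summability is invariant under reindexing by `x ↦ x + A l`. [folklore] -/
theorem summable_shift_iff {α : Type*} [AddCommMonoid α] [TopologicalSpace α] (F : EuclideanSpace ℝ (Fin 3) → α)
    {l : EuclideanSpace ℝ (Fin 3)} (hl : l ∈ Λ₀) :
    Summable (fun x : Sites₀ t A => F ((x : EuclideanSpace ℝ (Fin 3)) + A l)) ↔ Summable (fun x : Sites₀ t A => F x) := by
  obtain ⟨e, he⟩ := exists_sitesShift (t := t) (A := A) hl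
  have : (fun x : Sites₀ t A => F ((x : EuclideanSpace ℝ (Fin 3)) + A l)) = (fun x : Sites₀ t A => F x) ∘ e := by
    funext x; simp [he x]
  rw [this]
  exact e.summable_iff

/-- Summability is invariant under reindexing by `x ↦ x − A l`. [folklore] -/
theorem summable_shift_iff' {α : Type*} [AddCommMonoid α] [TopologicalSpace α] (F : EuclideanSpace ℝ (Fin 3) → α)
    {l : EuclideanSpace ℝ (Fin 3)} (hl : l ∈ Λ₀) :
    Summable (fun x : Sites₀ t A => F ((x : EuclideanSpace ℝ (Fin 3)) - A l)) ↔ Summable (fun x : Sites₀ t A => F x) := by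
  have h := summable_shift_iff (t := t) (A := A) F (neg_mem_Λ₀ hl)
  simpa [sub_eq_add_neg] using h

/-! ## Two-term Minkowski and the telescoping bound -/

/-- **Two-term Minkowski in `ℓ²`, squared form.** [folklore] -/
theorem sq_summable_add {α V : Type*} [NormedAddCommGroup V] {f g : α → V} {a b : ℝ} (ha : 0 ≤ a) (hb : 0 ≤ b)
    (hf : Summable (fun x => ‖f x‖ ^ 2) ∧ ∑' x, ‖f x‖ ^ 2 ≤ a ^ 2)
    (hg : Summable (fun x => ‖g x‖ ^ 2) ∧ ∑' x, ‖g x‖ ^ 2 ≤ b ^ 2) :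
    Summable (fun x => ‖f x + g x‖ ^ 2) ∧ ∑' x, ‖f x + g x‖ ^ 2 ≤ (a + b) ^ 2 := by
  have h := tsum_norm_sq_le_of_hasSum (ι := Bool) (fun c x => if c then f x else g x) (fun x => f x + g x)
    (fun c => if c then a else b) (fun c => by cases c <;> simp [ha, hb]) (summable_of_hasFiniteSupport (Set.toFinite _))
    (fun c => by cases c <;> simp [hf.1, hf.2, hg.1, hg.2])
    (fun x => by
      have := hasSum_fintype (fun c : Bool => if c then f x else g x)
      simpa [Fintype.sum_bool] using this)
  simpa [tsum_bool] using h

/-- **Telescoping bound for lattice translations.**  If the one-step translation differences of `G` along the three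
generators are square-summable with bound `B²` (in the form of clause (iv)), then for every `z(i,j,k)`
`Σ'_x ‖G x − G(x − A z(i,j,k))‖² ≤ ((|i| + |j| + |k|)·B)²`. [folklore] -/
theorem translate_sq_le (G : EuclideanSpace ℝ (Fin 3) → EuclideanSpace ℝ (Fin 3)) {B : ℝ} (hB : 0 ≤ B)
    (hstep : ∀ g ∈ ({triangularVec₁ 1, triangularVec₂ 1, layerNormal (2 * Real.sqrt (2 / 3))} :
        Finset (EuclideanSpace ℝ (Fin 3))),
      Summable (fun x : Sites₀ t A => ‖G ((x : EuclideanSpace ℝ (Fin 3)) + A g) - G x‖ ^ 2) ∧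
        ∑' x : Sites₀ t A, ‖G ((x : EuclideanSpace ℝ (Fin 3)) + A g) - G x‖ ^ 2 ≤ B ^ 2)
    (i j k : ℤ) :
    Summable (fun x : Sites₀ t A => ‖G x - G ((x : EuclideanSpace ℝ (Fin 3)) -
        A ((i : ℝ) • triangularVec₁ 1 + (j : ℝ) • triangularVec₂ 1 + (k : ℝ) • layerNormal (2 * Real.sqrt (2 / 3))))‖ ^ 2) ∧
      ∑' x : Sites₀ t A, ‖G x - G ((x : EuclideanSpace ℝ (Fin 3)) -
        A ((i : ℝ) • triangularVec₁ 1 + (j : ℝ) • triangularVec₂ 1 + (k : ℝ) • layerNormal (2 * Real.sqrt (2 / 3))))‖ ^ 2 ≤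
        ((|(i : ℝ)| + |(j : ℝ)| + |(k : ℝ)|) * B) ^ 2 := by
  -- the one-step bounds in both directions, for a generator `g`
  have hgen : ∀ g ∈ ({triangularVec₁ 1, triangularVec₂ 1, layerNormal (2 * Real.sqrt (2 / 3))} :
      Finset (EuclideanSpace ℝ (Fin 3))), g ∈ Λ₀ := by
    intro g hg
    simp only [Finset.mem_insert, Finset.mem_singleton] at hg
    rcases hg with rfl | rfl | rfl
    · simpa using latticeVec_mem_Λ₀ 1 0 0
    · simpa using latticeVec_mem_Λ₀ 0 1 0
    · simpa using latticeVec_mem_Λ₀ 0 0 1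
  have hminus : ∀ g ∈ ({triangularVec₁ 1, triangularVec₂ 1, layerNormal (2 * Real.sqrt (2 / 3))} :
      Finset (EuclideanSpace ℝ (Fin 3))),
      Summable (fun x : Sites₀ t A => ‖G x - G ((x : EuclideanSpace ℝ (Fin 3)) - A g)‖ ^ 2) ∧
        ∑' x : Sites₀ t A, ‖G x - G ((x : EuclideanSpace ℝ (Fin 3)) - A g)‖ ^ 2 ≤ B ^ 2 := by
    intro g hg
    have hF := (hstep g hg)
    have h1 := (summable_shift_iff' (t := t) (A := A)
      (fun y => ‖G (y + A g) - G y‖ ^ 2) (hgen g hg)).2 hF.1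
    have h2 := tsum_shift_eq' (t := t) (A := A) (fun y => ‖G (y + A g) - G y‖ ^ 2) (hgen g hg)
    simp only [sub_add_cancel] at h1 h2
    exact ⟨h1, h2 ▸ hF.2⟩
  have hplus : ∀ g ∈ ({triangularVec₁ 1, triangularVec₂ 1, layerNormal (2 * Real.sqrt (2 / 3))} :
      Finset (EuclideanSpace ℝ (Fin 3))),
      Summable (fun x : Sites₀ t A => ‖G x - G ((x : EuclideanSpace ℝ (Fin 3)) + A g)‖ ^ 2) ∧
        ∑' x : Sites₀ t A, ‖G x - G ((x : EuclideanSpace ℝ (Fin 3)) + A g)‖ ^ 2 ≤ B ^ 2 := by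
    intro g hg
    simpa only [norm_sub_rev] using hstep g hg
  -- generic step: from `v` to `v + g` and to `v - g`
  have stepP : ∀ (v g : EuclideanSpace ℝ (Fin 3)) (n : ℝ), 0 ≤ n → v ∈ Λ₀ →
      g ∈ ({triangularVec₁ 1, triangularVec₂ 1, layerNormal (2 * Real.sqrt (2 / 3))} : Finset (EuclideanSpace ℝ (Fin 3))) →
      (Summable (fun x : Sites₀ t A => ‖G x - G ((x : EuclideanSpace ℝ (Fin 3)) - A v)‖ ^ 2) ∧
        ∑' x : Sites₀ t A, ‖G x - G ((x : EuclideanSpace ℝ (Fin 3)) - A v)‖ ^ 2 ≤ (n * B) ^ 2) →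
      (Summable (fun x : Sites₀ t A => ‖G x - G ((x : EuclideanSpace ℝ (Fin 3)) - A (v + g))‖ ^ 2) ∧
        ∑' x : Sites₀ t A, ‖G x - G ((x : EuclideanSpace ℝ (Fin 3)) - A (v + g))‖ ^ 2 ≤ ((n + 1) * B) ^ 2) := by
    intro v g n hn hv hg hP
    have hQ := hminus g hg
    have hQ1 := (summable_shift_iff' (t := t) (A := A)
      (fun y => ‖G y - G (y - A g)‖ ^ 2) hv).2 hQ.1
    have hQ2 := tsum_shift_eq' (t := t) (A := A) (fun y => ‖G y - G (y - A g)‖ ^ 2) hv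
    have hsum := sq_summable_add (mul_nonneg hn hB) hB hP ⟨hQ1, hQ2.trans_le hQ.2⟩
    have heq : ∀ x : Sites₀ t A, G x - G ((x : EuclideanSpace ℝ (Fin 3)) - A (v + g)) =
        (G x - G ((x : EuclideanSpace ℝ (Fin 3)) - A v)) +
          (G ((x : EuclideanSpace ℝ (Fin 3)) - A v) - G ((x : EuclideanSpace ℝ (Fin 3)) - A v - A g)) := by
      intro x; rw [map_add, sub_add_eq_sub_sub]; abel
    simp only [heq]
    refine ⟨hsum.1, hsum.2.trans (le_of_eq (by ring))⟩
  have stepM : ∀ (v g : EuclideanSpace ℝ (Fin 3)) (n : ℝ), 0 ≤ n → v ∈ Λ₀ →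
      g ∈ ({triangularVec₁ 1, triangularVec₂ 1, layerNormal (2 * Real.sqrt (2 / 3))} : Finset (EuclideanSpace ℝ (Fin 3))) →
      (Summable (fun x : Sites₀ t A => ‖G x - G ((x : EuclideanSpace ℝ (Fin 3)) - A v)‖ ^ 2) ∧
        ∑' x : Sites₀ t A, ‖G x - G ((x : EuclideanSpace ℝ (Fin 3)) - A v)‖ ^ 2 ≤ (n * B) ^ 2) →
      (Summable (fun x : Sites₀ t A => ‖G x - G ((x : EuclideanSpace ℝ (Fin 3)) - A (v - g))‖ ^ 2) ∧
        ∑' x : Sites₀ t A, ‖G x - G ((x : EuclideanSpace ℝ (Fin 3)) - A (v - g))‖ ^ 2 ≤ ((n + 1) * B) ^ 2) := by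
    intro v g n hn hv hg hP
    have hQ := hplus g hg
    have hQ1 := (summable_shift_iff' (t := t) (A := A)
      (fun y => ‖G y - G (y + A g)‖ ^ 2) hv).2 hQ.1
    have hQ2 := tsum_shift_eq' (t := t) (A := A) (fun y => ‖G y - G (y + A g)‖ ^ 2) hv
    have hsum := sq_summable_add (mul_nonneg hn hB) hB hP ⟨hQ1, hQ2.trans_le hQ.2⟩
    have heq : ∀ x : Sites₀ t A, G x - G ((x : EuclideanSpace ℝ (Fin 3)) - A (v - g)) =
        (G x - G ((x : EuclideanSpace ℝ (Fin 3)) - A v)) +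
          (G ((x : EuclideanSpace ℝ (Fin 3)) - A v) - G ((x : EuclideanSpace ℝ (Fin 3)) - A v + A g)) := by
      intro x; rw [map_sub, sub_sub_eq_add_sub, add_sub_right_comm]; abel
    simp only [heq]
    refine ⟨hsum.1, hsum.2.trans (le_of_eq (by ring))⟩
  -- base case
  have base : Summable (fun x : Sites₀ t A => ‖G x - G ((x : EuclideanSpace ℝ (Fin 3)) - A 0)‖ ^ 2) ∧
      ∑' x : Sites₀ t A, ‖G x - G ((x : EuclideanSpace ℝ (Fin 3)) - A 0)‖ ^ 2 ≤ (0 * B) ^ 2 := by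
    simp
  have hu₁ : (triangularVec₁ 1 : EuclideanSpace ℝ (Fin 3)) ∈
      ({triangularVec₁ 1, triangularVec₂ 1, layerNormal (2 * Real.sqrt (2 / 3))} : Finset (EuclideanSpace ℝ (Fin 3))) := by
    simp
  have hu₂ : (triangularVec₂ 1 : EuclideanSpace ℝ (Fin 3)) ∈
      ({triangularVec₁ 1, triangularVec₂ 1, layerNormal (2 * Real.sqrt (2 / 3))} : Finset (EuclideanSpace ℝ (Fin 3))) := by
    simp
  have hw₃ : (layerNormal (2 * Real.sqrt (2 / 3)) : EuclideanSpace ℝ (Fin 3)) ∈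
      ({triangularVec₁ 1, triangularVec₂ 1, layerNormal (2 * Real.sqrt (2 / 3))} : Finset (EuclideanSpace ℝ (Fin 3))) := by
    simp
  -- casts of the integer coordinates
  have cast1 : ∀ n : ℕ, |(((n : ℤ) : ℝ))| = n := fun n => by
    rw [Int.cast_natCast, Nat.abs_cast]
  have cast2 : ∀ n : ℕ, |((((n : ℤ) + 1 : ℤ)) : ℝ)| = n + 1 := fun n => by
    rw [show (((n : ℤ) + 1 : ℤ) : ℝ) = (n : ℝ) + 1 by push_cast; ring]
    exact abs_of_nonneg (by positivity)
  have cast3 : ∀ n : ℕ, |(((-(n : ℤ) : ℤ)) : ℝ)| = n := fun n => by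
    rw [show (((-(n : ℤ) : ℤ)) : ℝ) = -(n : ℝ) by push_cast; ring, abs_neg, Nat.abs_cast]
  have cast4 : ∀ n : ℕ, |(((-(n : ℤ) - 1 : ℤ)) : ℝ)| = n + 1 := fun n => by
    rw [show (((-(n : ℤ) - 1 : ℤ)) : ℝ) = -((n : ℝ) + 1) by push_cast; ring, abs_neg]
    exact abs_of_nonneg (by positivity)
  -- induction along `u₁`
  have P1 : ∀ i : ℤ, Summable (fun x : Sites₀ t A => ‖G x - G ((x : EuclideanSpace ℝ (Fin 3)) -
      A ((i : ℝ) • triangularVec₁ 1 + ((0 : ℤ) : ℝ) • triangularVec₂ 1 + ((0 : ℤ) : ℝ) • layerNormal (2 * Real.sqrt (2 / 3))))‖ ^ 2) ∧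
      ∑' x : Sites₀ t A, ‖G x - G ((x : EuclideanSpace ℝ (Fin 3)) -
      A ((i : ℝ) • triangularVec₁ 1 + ((0 : ℤ) : ℝ) • triangularVec₂ 1 + ((0 : ℤ) : ℝ) • layerNormal (2 * Real.sqrt (2 / 3))))‖ ^ 2 ≤
        (|(i : ℝ)| * B) ^ 2 := by
    intro i
    induction i using Int.induction_on with
    | zero => simp
    | succ n ih =>
      have h := stepP _ _ (|((n : ℤ) : ℝ)|) (abs_nonneg _) (latticeVec_mem_Λ₀ n 0 0) hu₁ ih
      rw [← (latticeVec_succ (n : ℤ) 0 0).1] at h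
      have habs : |((n : ℤ) : ℝ)| + 1 = |(((n : ℤ) + 1 : ℤ) : ℝ)| := by rw [cast1, cast2]
      rw [habs] at h
      exact h
    | pred n ih =>
      have h := stepM _ _ (|((-(n : ℤ) : ℤ) : ℝ)|) (abs_nonneg _) (latticeVec_mem_Λ₀ (-(n : ℤ)) 0 0) hu₁ ih
      have hvec : ((((-(n : ℤ) : ℤ) : ℝ)) • triangularVec₁ 1 + ((0 : ℤ) : ℝ) • triangularVec₂ 1 +
          ((0 : ℤ) : ℝ) • layerNormal (2 * Real.sqrt (2 / 3)) : EuclideanSpace ℝ (Fin 3)) - triangularVec₁ 1 =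
          (((-(n : ℤ) - 1 : ℤ) : ℝ)) • triangularVec₁ 1 + ((0 : ℤ) : ℝ) • triangularVec₂ 1 +
          ((0 : ℤ) : ℝ) • layerNormal (2 * Real.sqrt (2 / 3)) := by
        have := (latticeVec_succ (-(n : ℤ) - 1) 0 0).1
        rw [show (-(n : ℤ) - 1 + 1 : ℤ) = -(n : ℤ) by ring] at this
        rw [this]; abel
      rw [hvec] at h
      have habs : |((-(n : ℤ) : ℤ) : ℝ)| + 1 = |(((-(n : ℤ) - 1 : ℤ)) : ℝ)| := by rw [cast3, cast4]
      rw [habs] at h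
      exact h
  -- induction along `u₂`
  have P2 : ∀ i j : ℤ, Summable (fun x : Sites₀ t A => ‖G x - G ((x : EuclideanSpace ℝ (Fin 3)) -
      A ((i : ℝ) • triangularVec₁ 1 + (j : ℝ) • triangularVec₂ 1 + ((0 : ℤ) : ℝ) • layerNormal (2 * Real.sqrt (2 / 3))))‖ ^ 2) ∧
      ∑' x : Sites₀ t A, ‖G x - G ((x : EuclideanSpace ℝ (Fin 3)) -
      A ((i : ℝ) • triangularVec₁ 1 + (j : ℝ) • triangularVec₂ 1 + ((0 : ℤ) : ℝ) • layerNormal (2 * Real.sqrt (2 / 3))))‖ ^ 2 ≤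
        ((|(i : ℝ)| + |(j : ℝ)|) * B) ^ 2 := by
    intro i j
    induction j using Int.induction_on with
    | zero => simpa using P1 i
    | succ n ih =>
      have h := stepP _ _ (|(i : ℝ)| + |((n : ℤ) : ℝ)|) (by positivity) (latticeVec_mem_Λ₀ i n 0) hu₂ ih
      rw [← (latticeVec_succ i (n : ℤ) 0).2.1] at h
      have habs : |(i : ℝ)| + |((n : ℤ) : ℝ)| + 1 = |(i : ℝ)| + |(((n : ℤ) + 1 : ℤ) : ℝ)| := by rw [cast1, cast2]; ring
      rw [habs] at h
      exact h
    | pred n ih =>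
      have h := stepM _ _ (|(i : ℝ)| + |((-(n : ℤ) : ℤ) : ℝ)|) (by positivity) (latticeVec_mem_Λ₀ i (-(n : ℤ)) 0) hu₂ ih
      have hvec : (((i : ℝ)) • triangularVec₁ 1 + (((-(n : ℤ) : ℤ) : ℝ)) • triangularVec₂ 1 +
          ((0 : ℤ) : ℝ) • layerNormal (2 * Real.sqrt (2 / 3)) : EuclideanSpace ℝ (Fin 3)) - triangularVec₂ 1 =
          ((i : ℝ)) • triangularVec₁ 1 + (((-(n : ℤ) - 1 : ℤ) : ℝ)) • triangularVec₂ 1 +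
          ((0 : ℤ) : ℝ) • layerNormal (2 * Real.sqrt (2 / 3)) := by
        have := (latticeVec_succ i (-(n : ℤ) - 1) 0).2.1
        rw [show (-(n : ℤ) - 1 + 1 : ℤ) = -(n : ℤ) by ring] at this
        rw [this]; abel
      rw [hvec] at h
      have habs : |(i : ℝ)| + |((-(n : ℤ) : ℤ) : ℝ)| + 1 = |(i : ℝ)| + |(((-(n : ℤ) - 1 : ℤ)) : ℝ)| := by rw [cast3, cast4]; ring
      rw [habs] at h
      exact h
  -- induction along `w₃`
  induction k using Int.induction_on with
  | zero => simpa using P2 i j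
  | succ n ih =>
    have h := stepP _ _ (|(i : ℝ)| + |(j : ℝ)| + |((n : ℤ) : ℝ)|) (by positivity) (latticeVec_mem_Λ₀ i j n) hw₃ ih
    rw [← (latticeVec_succ i j (n : ℤ)).2.2] at h
    have habs : |(i : ℝ)| + |(j : ℝ)| + |((n : ℤ) : ℝ)| + 1 = |(i : ℝ)| + |(j : ℝ)| + |(((n : ℤ) + 1 : ℤ) : ℝ)| := by
      rw [cast1, cast2]; ring
    rw [habs] at h
    exact h
  | pred n ih =>
    have h := stepM _ _ (|(i : ℝ)| + |(j : ℝ)| + |((-(n : ℤ) : ℤ) : ℝ)|) (by positivity) (latticeVec_mem_Λ₀ i j (-(n : ℤ))) hw₃ ih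
    have hvec : (((i : ℝ)) • triangularVec₁ 1 + ((j : ℝ)) • triangularVec₂ 1 +
        (((-(n : ℤ) : ℤ) : ℝ)) • layerNormal (2 * Real.sqrt (2 / 3)) : EuclideanSpace ℝ (Fin 3)) - layerNormal (2 * Real.sqrt (2 / 3)) =
        ((i : ℝ)) • triangularVec₁ 1 + ((j : ℝ)) • triangularVec₂ 1 +
        (((-(n : ℤ) - 1 : ℤ) : ℝ)) • layerNormal (2 * Real.sqrt (2 / 3)) := by
      have := (latticeVec_succ i j (-(n : ℤ) - 1)).2.2
      rw [show (-(n : ℤ) - 1 + 1 : ℤ) = -(n : ℤ) by ring] at this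
      rw [this]; abel
    rw [hvec] at h
    have habs : |(i : ℝ)| + |(j : ℝ)| + |((-(n : ℤ) : ℤ) : ℝ)| + 1 = |(i : ℝ)| + |(j : ℝ)| + |(((-(n : ℤ) - 1 : ℤ)) : ℝ)| := by
      rw [cast3, cast4]; ring
    rw [habs] at h
    exact h

/-! ## Covariance of the response to a point force -/

/-- A moved point force is the translate of the point force: `δ_{a + Ae} ξ = (δ_a ξ)(· − Ae)`. [folklore] -/
theorem single_translate (a e ξ : EuclideanSpace ℝ (Fin 3)) :
    (fun x : EuclideanSpace ℝ (Fin 3) => if x = a + A e then ξ else 0) =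
      fun x => (fun y : EuclideanSpace ℝ (Fin 3) => if y = a then ξ else 0) (x - A e) := by
  funext x
  dsimp only
  split_ifs with h1 h2 h2
  · rfl
  · exact absurd (by rw [h1, add_sub_cancel_right]) h2
  · exact absurd (by rw [← h2, sub_add_cancel]) h1
  · rfl

/-- **Covariance of the response to a point force**: under clause (vi) (lattice covariance of `𝒢` on admissible
right-hand sides) and a capacity inequality (which makes point forces admissible), for `a ∈ S`, `e ∈ Λ₀`:
`𝒢 (δ_{a+Ae} ξ) x = 𝒢 (δ_a ξ) (x − Ae)` at every site `x`. [folklore] -/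
theorem green_single_translate (𝒢 : (EuclideanSpace ℝ (Fin 3) → EuclideanSpace ℝ (Fin 3)) →
      EuclideanSpace ℝ (Fin 3) → EuclideanSpace ℝ (Fin 3)) {C₁ : ℝ}
    (hcap : ∀ w : EuclideanSpace ℝ (Fin 3) → EuclideanSpace ℝ (Fin 3), (Function.support w).Finite →
      Function.support w ⊆ Sites₀ t A → ∀ p ∈ Sites₀ t A, ‖w p‖ ^ 2 ≤ C₁ * nnForm t A w)
    (hcov : ∀ (f : EuclideanSpace ℝ (Fin 3) → EuclideanSpace ℝ (Fin 3)) (N : ℝ), 0 ≤ N →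
      (∀ w : EuclideanSpace ℝ (Fin 3) → EuclideanSpace ℝ (Fin 3), (Function.support w).Finite →
        Function.support w ⊆ Sites₀ t A → |∑' p : Sites₀ t A, ⟪f p, w p⟫| ≤ N * Real.sqrt (nnForm t A w)) →
      ∀ e ∈ Λ₀, (∀ w : EuclideanSpace ℝ (Fin 3) → EuclideanSpace ℝ (Fin 3), (Function.support w).Finite →
        Function.support w ⊆ Sites₀ t A →
          |∑' p : Sites₀ t A, ⟪f (p - A e), w p⟫| ≤ N * Real.sqrt (nnForm t A w)) →
      ∀ p ∈ Sites₀ t A, 𝒢 (fun x => f (x - A e)) p = 𝒢 f (p - A e))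
    {a : EuclideanSpace ℝ (Fin 3)} (ha : a ∈ Sites₀ t A) {e : EuclideanSpace ℝ (Fin 3)} (he : e ∈ Λ₀)
    (ξ : EuclideanSpace ℝ (Fin 3)) {x : EuclideanSpace ℝ (Fin 3)} (hx : x ∈ Sites₀ t A) :
    𝒢 (fun y => if y = a + A e then ξ else 0) x = 𝒢 (fun y => if y = a then ξ else 0) (x - A e) := by
  have hN : 0 ≤ Real.sqrt C₁ * ‖ξ‖ := by positivity
  have hadm := adm_single (t := t) (A := A) hcap ha ξ
  have hae : a + A e ∈ Sites₀ t A := add_mem_sites₀ ha he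
  -- admissibility of the translated point force, proved directly (no rewriting under binders)
  have hadm' : ∀ w : EuclideanSpace ℝ (Fin 3) → EuclideanSpace ℝ (Fin 3), (Function.support w).Finite →
      Function.support w ⊆ Sites₀ t A →
        |∑' p : Sites₀ t A, ⟪(fun y : EuclideanSpace ℝ (Fin 3) => if y = a then ξ else 0) (p - A e), w p⟫| ≤
          (Real.sqrt C₁ * ‖ξ‖) * Real.sqrt (nnForm t A w) := by
    intro w hw hwS
    have hsum : ∑' p : Sites₀ t A, ⟪(fun y : EuclideanSpace ℝ (Fin 3) => if y = a then ξ else 0) (p - A e), w p⟫ =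
        ⟪ξ, w (a + A e)⟫ := by
      rw [tsum_eq_single (⟨a + A e, hae⟩ : Sites₀ t A)]
      · dsimp only [Subtype.coe_mk]
        rw [if_pos (add_sub_cancel_right a (A e))]
      · intro p hp
        have hp' : (p : EuclideanSpace ℝ (Fin 3)) - A e ≠ a := by
          intro h
          apply hp
          apply Subtype.ext
          show (p : EuclideanSpace ℝ (Fin 3)) = a + A e
          rw [← h, sub_add_cancel]
        dsimp only
        rw [if_neg hp', inner_zero_left]
    rw [hsum]
    have h1 := hcap w hw hwS (a + A e) hae
    have h2 : ‖w (a + A e)‖ ≤ Real.sqrt C₁ * Real.sqrt (nnForm t A w) := by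
      rw [← Real.sqrt_mul' _ (nnForm_nonneg t A w), ← Real.sqrt_sq (norm_nonneg (w (a + A e)))]
      exact Real.sqrt_le_sqrt h1
    calc |⟪ξ, w (a + A e)⟫| ≤ ‖ξ‖ * ‖w (a + A e)‖ := abs_real_inner_le_norm _ _
      _ ≤ ‖ξ‖ * (Real.sqrt C₁ * Real.sqrt (nnForm t A w)) := mul_le_mul_of_nonneg_left h2 (norm_nonneg _)
      _ = Real.sqrt C₁ * ‖ξ‖ * Real.sqrt (nnForm t A w) := by ring
  have key := hcov (fun y : EuclideanSpace ℝ (Fin 3) => if y = a then ξ else 0) (Real.sqrt C₁ * ‖ξ‖) hN hadm e he hadm' x hx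
  rw [single_translate (A := A) a e ξ]
  exact key


/-- Registered sub-goal carrying this file (crux stmt-AtomisticToContinuum-9332, line `Sketch` v4, part H3b of
`stub_green`): the telescoping bound for lattice translations. [folklore] -/
theorem _root_.Summit.AtomisticToContinuum.Crystallization.Theorems.ExcessDecayLiouville.blowdown_greenShift :
    ∀ (t : Fin 2 → EuclideanSpace ℝ (Fin 3)) (A : EuclideanSpace ℝ (Fin 3) →L[ℝ] EuclideanSpace ℝ (Fin 3)) (G : EuclideanSpace ℝ (Fin 3) → EuclideanSpace ℝ (Fin 3)) (B : ℝ), 0 ≤ B → (∀ g ∈ ({triangularVec₁ 1, triangularVec₂ 1, layerNormal (2 * Real.sqrt (2 / 3))} : Finset (EuclideanSpace ℝ (Fin 3))), Summable (fun x : Sites₀ t A => ‖G ((x : EuclideanSpace ℝ (Fin 3)) + A g) - G x‖ ^ 2) ∧ ∑' x : Sites₀ t A, ‖G ((x : EuclideanSpace ℝ (Fin 3)) + A g) - G x‖ ^ 2 ≤ B ^ 2) → ∀ (i j k : ℤ), Summable (fun x : Sites₀ t A => ‖G x - G ((x : EuclideanSpace ℝ (Fin 3)) - A ((i : ℝ)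 • triangularVec₁ 1 + (j : ℝ) • triangularVec₂ 1 + (k : ℝ) • layerNormal (2 * Real.sqrt (2 / 3))))‖ ^ 2) ∧ ∑' x : Sites₀ t A, ‖G x - G ((x : EuclideanSpace ℝ (Fin 3)) - A ((i : ℝ) • triangularVec₁ 1 + (j : ℝ) • triangularVec₂ 1 + (k : ℝ) • layerNormal (2 * Real.sqrt (2 / 3))))‖ ^ 2 ≤ ((|(i : ℝ)| + |(j : ℝ)| + |(k : ℝ)|) * B) ^ 2 :=
  fun _ _ G _ hB hstep i j k => translate_sq_le G hB hstep i j k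

end

end Blowdown

end Summit.AtomisticToContinuum.Crystallization.Theorems.ExcessDecayLiouville

end
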